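import Summits.AnomalousDissipation.AnomalousDissipation.Theses.MirrorVariety
import Literature.Analysis.FunctionSpaces.TorusIntegerEndomorphism
import Literature.Analysis.FunctionSpaces.TorusFluidGlue
import Literature.Analysis.FluidPDE.BurgersVortexSteady
import Literature.Analysis.FluidPDE.BurgersVortexLayerSteady

/-!
# Sketch (crux-ideate r1, ideator 1) — crux `MirrorVariety.TaylorGreenLogLoudStates` (stmt-AnomalousDissipation-14586)

First lemmas / transfer statements of the two idea cards

* card A `fourfold-axis-burgers-columns` : `axis_pinning` (PROVED), `quarterTurn_axisPoint`, `TgForceIsGSymm`,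
  `GLogLoudSteadyStates` (PDE-level, G-symmetric log-loud steady states; feeds the crux through BRR/criticality);
* card B `odd-kerr-dold-wall-rows` : `WallParity` (K-parity of velocity/vorticity on a K-wall),
  `FaceCirculationLaw` (exact: ν ∫_F Δω₂ = −4/π on the quarter face F = [0,½]²×{0} for EVERY K-symmetric classical
  steady TG state), `OddRowsStayLoud` (C⁺: x₀-odd Kerr–Dold rows in uniform plane strain stay loud at log energy as ν → 0).

Everything is stated over tree declarations (`Torus.*`, `Torus.mulVecT`, `IsClassicalNSSolutionOn`,
`IsSteadyNSInStrain`, `planeStrain`, `frobeniusNormSq`). No new axioms; one `sorry`-free proof (`axis_pinning`).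
-/

noncomputable section

set_option linter.dupNamespace false

open scoped BigOperators Topology Classical MeasureTheory InnerProductSpace ComplexConjugate ContinuousMap
open Filter MeasureTheory
open Literature.Analysis.FunctionSpaces Literature.Analysis.FunctionSpaces.Torus
open Literature.Analysis.FluidPDE

namespace Summit.AnomalousDissipation.AnomalousDissipation.Cruxes.TaylorGreenLogLoudStates.SketchIdeator1

/-- Local notation. -/
local notation "𝕋³" => UnitAddTorus (Fin 3)
local notation "ℝ³" => EuclideanSpace ℝ (Fin 3)

/-! ## Vocabulary shared with `Lines/stagnation-plug-froth.lean` of the sibling crux (verbatim) -/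

/-- The Taylor–Green force of the crux, verbatim. -/
abbrev tgForce : 𝕋³ → ℝ³ := fun x =>
  !₂[(fourier 1 (x 0) : ℂ).im * (fourier 1 (x 1) : ℂ).re * (fourier 1 (x 2) : ℂ).re,
    -((fourier 1 (x 0) : ℂ).re * (fourier 1 (x 1) : ℂ).im * (fourier 1 (x 2) : ℂ).re), (0 : ℝ)]

/-- The reflection matrix `R_i = diag(1,…,-1 (slot i),…,1)`. -/
def reflMat (i : Fin 3) : Matrix (Fin 3) (Fin 3) ℤ :=
  Matrix.diagonal fun k => if k = i then -1 else 1

/-- Action of an integer matrix on vectors of `ℝ³` (the differential of `Torus.mulVecT M`). -/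
def actVec (M : Matrix (Fin 3) (Fin 3) ℤ) (v : ℝ³) : ℝ³ :=
  WithLp.toLp 2 ((M.map (Int.cast : ℤ → ℝ)).mulVec (WithLp.ofLp v))

/-- `K`-symmetry (the mirror class of the route): `u (R_i x) = R_i (u x)` for the three coordinate reflections. -/
def IsKSymm (u : 𝕋³ → ℝ³) : Prop :=
  ∀ (i : Fin 3) (x : 𝕋³), u (Torus.mulVecT (reflMat i) x) = actVec (reflMat i) (u x)

/-! ## The extra generators of the full Taylor–Green group `G` (card A) -/

/-- Integer part of the quarter turn about a vertical axis: `(v₀,v₁,v₂) ↦ (−v₁, v₀, v₂)`. -/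
def rotMat : Matrix (Fin 3) (Fin 3) ℤ := !![0, -1, 0; 1, 0, 0; 0, 0, 1]

/-- The half-period shift `(½, 0, 0)` of `T³`. -/
def halfShift0 : 𝕋³ := fun i => if i = 0 then (((2 : ℝ)⁻¹ : ℝ) : UnitAddCircle) else 0

/-- **Quarter turn** about the vertical axis through `(¼, ¼, ·)`: `x ↦ (½ − x₁, x₀, x₂)`.
Checked componentwise: `f_TG (quarterTurn x) = rotMat · f_TG x` (a PURE rotation symmetry of the TG force,
no screw; Brachet et al. 1983 §2). -/
def quarterTurn (x : 𝕋³) : 𝕋³ := Torus.mulVecT rotMat x + halfShift0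

/-- `C₄`-symmetry about the vertical axes: `u (ρ x) = ρ_* (u x)`. -/
def IsC4Symm (u : 𝕋³ → ℝ³) : Prop := ∀ x, u (quarterTurn x) = actVec rotMat (u x)

/-- Integer part of the half turn about a horizontal line: `(v₀,v₁,v₂) ↦ (−v₀, v₁, −v₂)`. -/
def flipMat02 : Matrix (Fin 3) (Fin 3) ℤ := Matrix.diagonal ![-1, 1, -1]

/-- The half-period shift `(½, 0, ½)`. -/
def halfShift02 : 𝕋³ := fun i => if i = 1 then 0 else (((2 : ℝ)⁻¹ : ℝ) : UnitAddCircle)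

/-- **Half turn** about the horizontal line `{x₀ = ¼, x₂ = ¼}` (direction `e₁`): `x ↦ (½ − x₀, x₁, ½ − x₂)`,
`v ↦ (−v₀, v₁, −v₂)`; checked componentwise to fix `f_TG`. Its fixed lines are the horizontal 2-fold axes at the
quarter heights `x₂ ∈ {¼, ¾}` where the forcing vanishes. -/
def halfTurnH (x : 𝕋³) : 𝕋³ := Torus.mulVecT flipMat02 x + halfShift02

/-- `C₂`-symmetry about the horizontal axes. -/
def IsC2HSymm (u : 𝕋³ → ℝ³) : Prop := ∀ x, u (halfTurnH x) = actVec flipMat02 (u x)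

/-- The full Taylor–Green symmetry used by card A: mirrors `K` + quarter turn + horizontal half turn. -/
def IsGSymm (u : 𝕋³ → ℝ³) : Prop := IsKSymm u ∧ IsC4Symm u ∧ IsC2HSymm u

/-- A `G`-field: smooth, divergence free, mean zero, `G`-symmetric. -/
def IsGField (u : 𝕋³ → ℝ³) : Prop := IsSmooth u ∧ IsDivFree u ∧ HasZeroMean u ∧ IsGSymm u

/-- `f_TG` is `G`-symmetric (statement; each generator checked by hand with `sin(π−θ) = sin θ`, `cos(π−θ) = −cos θ`). -/
def TgForceIsGSymm : Prop := IsGSymm tgForce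

/-- Components of the rotated vector. -/
theorem actVec_rotMat_apply (v : ℝ³) :
    actVec rotMat v 0 = -v 1 ∧ actVec rotMat v 1 = v 0 ∧ actVec rotMat v 2 = v 2 := by
  refine ⟨?_, ?_, ?_⟩ <;>
    simp [actVec, rotMat, Matrix.mulVec, dotProduct, Fin.sum_univ_three, Matrix.map_apply]

/-- **Card A · First lemma (PINNING).** On a fixed point of the quarter turn — the vertical axes through the cell
centres `(¼,¼,·)`, `(¾,¾,·)` — every `C₄`-symmetric field is VERTICAL: the axis is a straight streamline of every
`G`-field at every `ν` and `N`, so a vortex column placed there has no drift and no translation zero-mode, and (same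
computation on `∇u`) its transverse strain is exactly axisymmetric (Gallay–Wayne asymmetry parameter `λ = 0`). [folklore] -/
theorem axis_pinning {u : 𝕋³ → ℝ³} (hu : IsC4Symm u) {x : 𝕋³} (hx : quarterTurn x = x) :
    u x 0 = 0 ∧ u x 1 = 0 := by
  have h := hu x
  rw [hx] at h
  obtain ⟨h0, h1, -⟩ := actVec_rotMat_apply (u x)
  have e0 : u x 0 = -(u x 1) := by rw [← h0, ← h]
  have e1 : u x 1 = u x 0 := by rw [← h1, ← h]
  constructor <;> linarith

/-- The axis points are indeed fixed: `(¼, ¼, t)` is a fixed point of `quarterTurn` (statement; `½ − ¼ = ¼`). -/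
def axisPoint (t : ℝ) : 𝕋³ := fun i => if i = 2 then ((t : ℝ) : UnitAddCircle) else (((4 : ℝ)⁻¹ : ℝ) : UnitAddCircle)

/-- `quarterTurn` fixes the axis (statement). [folklore] -/
def QuarterTurnFixesAxis : Prop := ∀ t : ℝ, quarterTurn (axisPoint t) = axisPoint t

/-- **Card A · PDE-level target** (what the column skeleton is to deliver; the crux follows by Brezzi–Rappaz–Raviart
transfer + symmetric criticality exactly as in `Lines/stagnation-plug-froth.lean` of the sibling crux, with energy
margin `E·log` instead of `E`): `G`-symmetric classical steady Taylor–Green states along `ν_j → 0⁺` with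
`∫|u_j|² ≤ E log(1/ν_j)` and `ν_j‖∇u_j‖² ≥ c`. -/
def GLogLoudSteadyStates : Prop :=
  ∃ (ν : ℕ → ℝ) (E c : ℝ), (∀ j, 0 < ν j ∧ ν j ≤ 1 / 4) ∧ Tendsto ν atTop (𝓝 0) ∧ 0 < c ∧
    ∀ j, ∃ (u : 𝕋³ → ℝ³) (p : 𝕋³ → ℝ),
      IsClassicalNSSolutionOn Set.univ (ν j) (fun _ => tgForce) (fun _ => u) (fun _ => p) ∧
      IsGField u ∧ ∫ x, ‖u x‖ ^ 2 ≤ E * Real.log (1 / ν j) ∧ c ≤ ν j * gradNormSq u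

/-- Enstrophy carried by the tube of radius `r` around the vertical axis through `(¼,¼,·)` (column fingerprint used by
card A's falsifier: along a column family this is `≥ (1−θ)·‖∇u‖²/4` per axis with `r = R·(ν/s)^{1/2}`). -/
def axisTubeEnstrophy (r : ℝ) (u : 𝕋³ → ℝ³) : ℝ :=
  ∫ x in {x : 𝕋³ | ‖(x 0 - (((4 : ℝ)⁻¹ : ℝ) : UnitAddCircle))‖ ^ 2 + ‖(x 1 - (((4 : ℝ)⁻¹ : ℝ) : UnitAddCircle))‖ ^ 2 < r ^ 2},
    ∑ i : Fin 3, ‖partialDeriv i u x‖ ^ 2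

/-! ## Card B: K-parity on the walls, the face-circulation law, odd Kerr–Dold rows -/

/-- Vorticity on `T³` with the tree's `Torus.partialDeriv` (indices `0,1,2`; same formula as BDSV's torus `curl`). -/
def vort (u : 𝕋³ → ℝ³) (x : 𝕋³) : ℝ³ :=
  WithLp.toLp 2 ![partialDeriv 1 u x 2 - partialDeriv 2 u x 1,
    partialDeriv 2 u x 0 - partialDeriv 0 u x 2, partialDeriv 0 u x 1 - partialDeriv 1 u x 0]

/-- **Card B · First lemma (WALL PARITY).** On the K-wall `x₂ = 0` a smooth K-symmetric field is tangent
(`u₂ = 0`) and its vorticity is NORMAL (`ω₀ = ω₁ = 0`): vortex tubes can only PIERCE a wall, never lie in it, and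
horizontal vorticity is odd across the wall — which is why Kerr's (2024, §4.1) ODD family of strained vortex rows
(tails of opposite sign, counter-rotating pairs straddling the plane, annihilation layer on it) is the relevant local
engine, not the even Kerr–Dold (1994) family. [folklore] -/
def WallParity : Prop :=
  ∀ u : 𝕋³ → ℝ³, IsSmooth u → IsKSymm u → ∀ x : 𝕋³, x 2 = 0 → u x 2 = 0 ∧ vort u x 0 = 0 ∧ vort u x 1 = 0

/-- The quarter face `F = [0,½]² × {x₂ = 0}` of Brachet's impermeable box, parametrised by `(y₀, y₁) ∈ [0,½]²`. -/
def quarterFace : Set (ℝ × ℝ) := Set.Icc (0 : ℝ) (1 / 2) ×ˢ Set.Icc (0 : ℝ) (1 / 2)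

/-- The point `(y₀, y₁, 0)` of the bottom wall. -/
def facePt (y : ℝ × ℝ) : 𝕋³ := fun i => if i = 0 then ((y.1 : ℝ) : UnitAddCircle) else if i = 1 then ((y.2 : ℝ) : UnitAddCircle) else 0

/-- **Card B · FACE-CIRCULATION LAW (exact, TG-specific; provable now, S–M).** For every viscosity `ν > 0` and every
K-symmetric classical steady state `(u,p)` of NS(`ν`, `f_TG`):
  `ν ∫_F (Δω)₂ dA = −∫_F (curl f_TG)₂ dA = −4/π`,  `F = [0,½]²×{0}`.
Proof: take the `e₂`-component of the steady vorticity equation on the wall; by K-parity `u₂ = ω₀ = ω₁ = 0` there, so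
`[(u·∇)ω − (ω·∇)u]₂ = ∇_h·(u_h ω₂)`, whose integral over `F` is `∮_{∂F} ω₂ u_h·n = 0` because the four edges lie on
the K-walls `x₀, x₁ ∈ {0,½}` where the normal velocity vanishes; and `(curl f_TG)₂ = 4π sin2πx₀ sin2πx₁ cos2πx₂`,
`∫_F = 4π·(1/π)² = 4/π`. Kelvin's theorem on a symmetry face: the force injects circulation `4/π` per unit time around
`∂F`, the nonlinearity cannot move circulation across symmetry edges, so viscosity must destroy it at a
`ν`-INDEPENDENT rate — every K-symmetric steady TG family has `sup|∇²ω| ≥ 16/(πν)` on the box faces (no smooth Euler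
limit in the mirror class) and a fixed circulation THROUGHPUT that the wall structures (annihilation layers / odd
Kerr–Dold rows) must process. [folklore] -/
def FaceCirculationLaw : Prop :=
  ∀ (ν : ℝ) (u : 𝕋³ → ℝ³) (p : 𝕋³ → ℝ), 0 < ν → IsKSymm u →
    IsClassicalNSSolutionOn Set.univ ν (fun _ => tgForce) (fun _ => u) (fun _ => p) →
      ν * ∫ y in quarterFace, laplacian (vort u) (facePt y) 2 = -(4 / Real.pi)

/-- The reflection `x₀ ↦ −x₀` of `ℝ³` (KD's plane of symmetry `z = 0` = the tree's compressive direction `x₀` of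
`planeStrain γ = diag(−γ, 0, γ)`). -/
def reflect0 (x : ℝ³) : ℝ³ := WithLp.toLp 2 ![-(x 0), x 1, x 2]

/-- The cross-section point `(y₀, y₁, 0)` of `ℝ³`. -/
def secPt (y : ℝ × ℝ) : ℝ³ := WithLp.toLp 2 ![y.1, y.2, 0]

/-- **Card B · Transfer object `C⁺` (ODD KERR–DOLD ROWS STAY LOUD).** In the uniform plane strain
`U = planeStrain γ = (−γx₀, 0, γx₂)` (compression onto the plane `x₀ = 0`, neutral direction `x₁`, stretching `x₂`)
there are, for every period `L > 0`, constants `c₀, E₀ > 0` such that for all small `ν > 0` an exact steady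
perturbation `v` exists (`IsSteadyNSInStrain ν U v`: `U + v` solves steady NS for some smooth pressure) which is
two-dimensional (`x₂`-independent, `v₂ = 0`: Kerr–Dold's class), `L`-periodic in the neutral direction, ODD across the
plane (`v(−x₀,x₁,x₂) = (−v₀,v₁,v₂)`, Kerr 2024 §4.1: vorticity tails of opposite sign — the parity a K-wall imposes,
cf. `WallParity`), with log-bounded energy and `ν`-INDEPENDENT dissipation per period and unit length:
`∫_{ℝ×[0,L]} |v|² ≤ E₀ log(1/ν)`, `ν ∫_{ℝ×[0,L]} |∇v|² ≥ c₀`. Kerr–Dold (1994) / Kerr (2024) give these states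
numerically at `λ = γ/(νk²) = 6, 8` (k = 2π/L) with core/tail vorticity ratios up to 400; the statement is their
persistence as a LOUD family along `λ → ∞` (each vortex a strained MKO/Gallay–Wayne core of circulation `Γ ≍ ΔU·L`
fed by the algebraic tail). Why easier than the crux: ONE local problem with uniform strain, two parameters
(`λ`, tail amplitude), reducible to Kerr's ODE–Fourier system (2.6) and decidable numerically in minutes; its failure
mode (rows thin back into the quiet `√ν` annihilation layer) is visible at finite `λ`. -/
def OddRowsStayLoud : Prop :=
  ∀ γ : ℝ, 0 < γ → ∀ L : ℝ, 0 < L → ∃ c₀ E₀ ν₀ : ℝ, 0 < c₀ ∧ 0 < ν₀ ∧ ∀ ν : ℝ, 0 < ν → ν < ν₀ →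
    ∃ v : ℝ³ → ℝ³, IsSteadyNSInStrain ν (planeStrain γ) v ∧
      (∀ x : ℝ³, ∀ t : ℝ, v (x + t • EuclideanSpace.single 2 1) = v x) ∧ (∀ x, v x 2 = 0) ∧
      (∀ x : ℝ³, v (x + L • EuclideanSpace.single 1 1) = v x) ∧
      (∀ x : ℝ³, v (reflect0 x) = reflect0 (v x)) ∧
      ∫ y in (Set.univ : Set ℝ) ×ˢ Set.Icc 0 L, ‖v (secPt y)‖ ^ 2 ≤ E₀ * Real.log (1 / ν) ∧
      c₀ ≤ ν * ∫ y in (Set.univ : Set ℝ) ×ˢ Set.Icc 0 L, frobeniusNormSq (fderiv ℝ v (secPt y))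

/-- Sanity link used by both cards: the crux is implied by its `∀ f = f_TG` instance (the binder is sugar). [folklore] -/
theorem crux_of_instance
    (h : ∃ (ν : ℕ → ℝ) (E c : ℝ), (∀ j, 0 < ν j ∧ ν j ≤ 1 / 4) ∧ Filter.Tendsto ν Filter.atTop (nhds 0) ∧ 0 < c ∧
      ∀ j, ∀ᶠ N in Filter.atTop, ∃ U : 𝕋³ → ℝ³,
        (IsSmooth U ∧ IsDivFree U ∧ HasZeroMean U ∧
          (∀ k ∉ (freqBall N).erase (0 : Fin 3 → ℤ), UnitAddTorus.mFourierCoeff (EuclideanSpace.complexify ∘ U) k = 0) ∧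
          ∀ a : 𝕋³ → ℝ³, IsSmooth a → IsDivFree a →
            (∀ k ∉ (freqBall N).erase (0 : Fin 3 → ℤ), UnitAddTorus.mFourierCoeff (EuclideanSpace.complexify ∘ a) k = 0) →
            ∫ x, (inner ℝ (U x) (convect U a x) + ν j * inner ℝ (U x) (laplacian a x) + inner ℝ (tgForce x) (a x)) = 0) ∧
        ∫ x, ‖U x‖ ^ 2 ≤ E * Real.log (1 / ν j) ∧ c ≤ ν j * gradNormSq U) :
    Summit.AnomalousDissipation.AnomalousDissipation.Theses.MirrorVariety.TaylorGreenLogLoudStates := by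
  rintro f rfl
  exact h

end Summit.AnomalousDissipation.AnomalousDissipation.Cruxes.TaylorGreenLogLoudStates.SketchIdeator1
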